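import Summits.BirchSwinnertonDyer.BirchSwinnertonDyer.Theorems.PrintCFramBottomClassIndexLawFiveLeEisensteinRegularLocusBSDp
import Summits.BirchSwinnertonDyer.BirchSwinnertonDyer.Theorems.SchneiderFreeAdditiveX3BranchIMCKrizLiLocus
import Summits.BirchSwinnertonDyer.BirchSwinnertonDyer.Theorems.AdditiveKolyvaginRoadBottomTransferKrizLiAtOne
import HarnessLib

/-!
# Route `PrintCFram`, crux C2 `BottomClassIndexLawFiveLe` (stmt-BirchSwinnertonDyer-20372), line `eisenstein-resource-bdp-line`:
# the REGULAR KRIZ–LI LOCUS — the crux's conclusion for `W` from PRINT ALONE (Kriz–Li 2019 Thm. 1.20 by name) plus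
# regularity of one frame and `p ∤ c`
# (cell `bsd-print-cfram`, width seat `bsd-line-cfram-p1-w4` g0; helper `--supports` 20372; THEOREMS ONLY, 0 defs, 0 facts minted)

HONEST FRAMING. Nothing about BSD is proved unconditionally; the crux is NOT closed (it quantifies over ALL CM-ramified `W` and
Kriz–Li's Bernoulli hypothesis (4) depends on the Heegner field). The companion `…EisensteinRegularLocusBSDp` (p629673) reduced
`BSD_p(W)` on a REGULAR frame (`ord_p f_ac(0) = 0`) to the one number `v_p(c) ≤ ord_p log_{ω_W}(P) ≤ v_p(c)`. Both inequalities
are discharged here from theorems ALREADY IN THE TREE: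
* `ord_p log_{ω_W}(P) ≤ v_p(c)` ⟸ Kriz–Li 2019 Thm. 1.20, typed as the named fact
  `KrizLi2019.thm120_padicLogHeegner_unit_of_bernoulli` (cell bsd-schneider), through door-c2's
  `SchneiderFree.padicLogOrd_le_padicValInt_of_krizLi` and `nsPointCount_eq_self_of_addv` (`|W̃^{ns}(𝔽_p)| = p` at an additive `p`);
* `v_p(c) ≤ ord_p log_{ω_W}(P)` ⟸ `p ∤ c` and INTEGRALITY of the `ℤ_p`-linear logarithm on `E(ℚ_p)` at an additive `p ≥ 5`
  (`AdditiveKoly.norm_padicLog_le_one_of_addv`, Kim's Lemma 3.10 regime; `padicLogOrd_nonneg_of_addv_of_five_le` below).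
So: **for `W` CM, `p ≥ 5` CM-ramified, `r_an = 1`, a Kriz–Li datum `(K'', P)` of `W` (Kriz–Li's binders (1)–(3) at `(W, p)`, the
Bernoulli-unit condition (4) at `K''`, `d_{K''}` odd `< −4`, `L(W^{(d)}, 1) ≠ 0`) with `p ∤ c` and ONE REGULAR anticyclotomic
frame: `BSD_p(W)` and `X12.O11.RamifiedCMBottomClassIndexLawAtZp W p` hold modulo PRINT only** — Kriz–Li Thm. 1.20,
`ToricPublishedInputs` (GZ, Kolyvagin, GZK, modularity, GZ I.7.3, parity, Friedberg–Hoffstein, Heegner points), Poitou–Tate for Ш,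
Burungale–Flach 2024, Cassels — with NO main conjecture, NO `p`-adic `L`-function, NO CGLS Prop. 14.
READING for the planner. On the Kriz–Li locus the LOWER socket holds at every frame (door-c2, any `n`), and the UPPER socket
`n + 2·v_p(c) ≤ 2·ord_p log = 2·v_p(c)` is EXACTLY `n = 0`: there the crux's entire research content is «the frame is regular»
(⟸ both character residual Selmer groups over `K''_∞` trivial, p629673 — heuristically the same condition as Kriz–Li's (4) via
Rubin's `GL₁` main conjecture, NOT typed here). Kriz–Li's binders are DISPLAYED, not discharged: for the class, (2) is vacuous
(CM ⇒ no multiplicative prime), (1)/(3) hold because both characters are ramified at `p` and at the twist primes (w2's trace form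
`traceForm_of_cmRamified` is the `hss` input in another currency) — a follow-up. THEOREMS ONLY; 0 definitions, 0 named facts,
0 `sorry`. BSD is not proved by any of this; no summit statement is proved by this seat.

References: [KrizLi2019] Thm. 1.20 (pp. 7–8) = Thm. 7.1, Rem. 1.17, Rem. 1.21, p. 3 (doi:10.1017/fms.2019.9);
[JetchevSkinnerWan2017] §7.4.1, Thm. 3.3.1 (arXiv:1512.06894); [Kim2022StructureSelmer] Lemma 3.10; [Castella2018] §2.2, Thm. 2.3.
-/

set_option autoImplicit false
-- `…BirchSwinnertonDyer.BirchSwinnertonDyer.Theorems…` is the problem's mandated namespace (D-0017).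
set_option linter.dupNamespace false

noncomputable section

open scoped Classical

namespace Summit.BirchSwinnertonDyer.BirchSwinnertonDyer.Theorems.PrintCFram.EisensteinRegularLocus

open WeierstrassCurve NumberField IsDedekindDomain Field
  Literature.NumberTheory.EllipticCurves Literature.NumberTheory.EllipticCurves.GreenbergSelmer
  Literature.NumberTheory.EllipticCurves.GreenbergVatsal2000
  Literature.NumberTheory.EllipticCurves.ModularForms Literature.NumberTheory.EllipticCurves.Rank1Residual
  Literature.NumberTheory.EllipticCurves.Rank1Residual.Typed
  Literature.NumberTheory.GaloisRepresentations Literature.NumberTheory.GaloisCohomology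
  Summit.BirchSwinnertonDyer.BirchSwinnertonDyer.Theses.UniversalToricDescent
  Summit.BirchSwinnertonDyer.Rank1Residual Summit.BirchSwinnertonDyer.Rank1Residual.Additive
  Summit.BirchSwinnertonDyer.Rank1Residual.X11b Summit.BirchSwinnertonDyer.Rank1Residual.X11b.AcSelmer
  Summit.BirchSwinnertonDyer.Rank1Residual.X12
  Summit.BirchSwinnertonDyer.Rank1Residual.X2.ResidualDevissageModules
  Summit.BirchSwinnertonDyer.BirchSwinnertonDyer.Theorems
  Summit.BirchSwinnertonDyer.BirchSwinnertonDyer.Theorems.RamifiedSevenEllipticUnits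
  Summit.BirchSwinnertonDyer.BirchSwinnertonDyer.Theorems.PrintCFram.EisensteinResourceBdpLine

/-! ## §1 Integrality: `0 ≤ ord_p log_{ω_W}(P)` at an additive `p ≥ 5` -/

section Integrality

variable {p : ℕ} [Fact p.Prime] {K : Type} [Field K] [NumberField K]

/-- **`0 ≤ ord_p log_{ω_W}(P)` for a point of infinite order at an ADDITIVE prime `p ≥ 5`.** The `ℤ_p`-linear logarithm of a
globally minimal `W` is integral on all of `W(ℚ_p)` when `p ∤ c_p` (Kodaira–Néron `c_p ≤ 4 < p`; the tree's
`AdditiveKoly.norm_padicLog_le_one_of_addv`, Kim's Lemma 3.10 regime), and `X11b.padicLogOrd` is the valuation of that logarithm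
at a point of infinite order (`LocalLog.padicLogOrd_eq_valuation_padicLog`). [cite: Kim2022StructureSelmer, Lemma 3.10 (PDF pp. 16–17)]
[cite: Castella2018, §2.2 (arXiv:1704.06608 p. 5)] -/
theorem padicLogOrd_nonneg_of_addv_of_five_le (W : WeierstrassCurve ℚ) [W.IsElliptic] [W.IsGloballyMinimal]
    (hp5 : 5 ≤ p) (hadd : Addv W p) (ι : K →+* ℚ_[p]) {P : (W.baseChange K).toAffine.Point}
    (hP : ¬ IsOfFinAddOrder P) : 0 ≤ X11b.padicLogOrd W p ι P := by
  have hPι : ¬ IsOfFinAddOrder (X11b.padicPointOf W p ι P) :=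
    O5.HeegnerLogTransport.not_isOfFinAddOrder_padicPointOf W p ι P hP
  rw [LocalLog.padicLogOrd_eq_valuation_padicLog W p ι P hPι]
  exact (Padic.norm_le_one_iff_val_nonneg _).mp (AdditiveKoly.norm_padicLog_le_one_of_addv W p hp5 hadd _)

end Integrality

/-! ## §2 The CM-ramified class on the regular Kriz–Li locus: `BSD_p` and the crux's conclusion, modulo print -/

section CMRamified

variable {p : ℕ} [Fact p.Prime]

/-- **`BSD_p(W)` on the REGULAR KRIZ–LI LOCUS, modulo PRINT only.** `W/ℚ` globally minimal CM, `p ≥ 5` CM-ramified,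
`r_an(W) = 1`; ONE Heegner datum `(N, K'', Dt, H, ι, P)` with `d_{K''}` odd `< −4`, `L(W^{(d)}, 1) ≠ 0` and `p ∤ c(Dt)`;
Kriz–Li's binders — at `(W, p)`: a primitive `ψ` of conductor `f` and the Teichmüller `ω` with `W[p]^{ss} ≅ 𝔽_p(ψ) ⊕ 𝔽_p(ψ⁻¹ω)`
in trace form, (1) `ψ(p) ≠ 1 ≠ (ψ⁻¹ω)(p)`, (2) no split multiplicative prime, (3) the additive-prime condition; at `K''`: the
Kronecker character `ε_K` and (4) `B_{1,ψ₀⁻¹ε_K} · B_{1,ψ₀ω⁻¹} ≢ 0 (mod p)` —; ONE anticyclotomic frame `(κ, γ, 𝔭 ∋ p)` of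
`K''` that is REGULAR (`XAc.HasCharValuationAt … 0`). THEN `BSD_p(W)`, from Kriz–Li 2019 Thm. 1.20 BY NAME (`hKL`) and the
citations `ToricPublishedInputs`, Poitou–Tate for Ш, Burungale–Flach 2024, modularity: `ord_p log_ω P ≤ v_p(c)` by door-c2's
`padicLogOrd_le_padicValInt_of_krizLi`, `0 ≤ ord_p log_ω P` by §1, `v_p(c) = 0`, then p629673's
`bsdp_cmRamified_of_regularFrame_of_padicLogOrd`. NO main conjecture, NO `p`-adic `L`-function. CONDITIONAL; closes nothing;
BSD is not proved by any of this. [cite: KrizLi2019, Thm. 1.20 (pp. 7–8), Rem. 1.17, Rem. 1.21 (doi:10.1017/fms.2019.9)]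
[cite: JetchevSkinnerWan2017, §7.4.1 and Thm. 3.3.1 (arXiv:1512.06894)] [cite: BurungaleFlach2024, Thm. 1.1 and Cor. 2] -/
theorem bsdp_cmRamified_of_regularFrame_of_thm120 (hKL : KrizLi2019.thm120_padicLogHeegner_unit_of_bernoulli)
    (hF : ToricPublishedInputs) (hPT2 : ∀ (K : Type) [Field K] [NumberField K], poitouTate_sha_tateDual K)
    (hBF : bsdTriple_of_hasCM_of_L_one_ne_zero) (hmod : hasEntireLFunction_rat)
    (W : WeierstrassCurve ℚ) [W.IsElliptic] [W.IsGloballyMinimal] (hCM : W.HasCM) (hram : CMRamified W p) (h5 : 5 ≤ p)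
    (hr : W.analyticRank = 1) (N : ℕ) [NeZero N] (K : Type) [Field K] [NumberField K]
    (Dt : ModularParametrizationData W N) (H : HeegnerDatum N (NumberField.discr K)) (ι : K →+* ℂ)
    (P : (W.baseChange K).toAffine.Point) (hN : W.conductorNorm ℤ = N) (hK : IsImaginaryQuadratic K)
    (hodd : Odd (NumberField.discr K)) (hd4 : NumberField.discr K < -4) (hHH : SatisfiesHeegnerHypothesis N K)
    (hLd : (W.quadraticTwist (NumberField.discr K : ℚ)).entireLFunction 1 ≠ 0)
    (hP : WeierstrassCurve.Affine.Point.map ι.toRatAlgHom P = heegnerPointComplex Dt H) (hc : ¬ (p : ℤ) ∣ Dt.c)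
    -- Kriz–Li's binders at `(W, p)`
    (f : ℕ) [NeZero f] (ψ : DirichletCharacter ℚ_[p] f) (ω : DirichletCharacter ℚ_[p] p)
    (hψ : ψ.IsPrimitive) (hω : KrizLi2019.IsTeichmullerCharacter ω)
    (hss : ∀ ℓ : ℕ, ℓ.Prime → ¬ (ℓ ∣ p * W.conductorNorm ℤ) →
      ‖((W.LFunction ℓ : ℤ) : ℚ_[p]) - (ψ (ℓ : ZMod f) + ψ⁻¹ (ℓ : ZMod f) * ω (ℓ : ZMod p))‖ < 1)
    (h1 : ψ (p : ZMod f) ≠ 1) (h1' : KrizLi2019.primVal (KrizLi2019.invMulOmega ψ ω) p ≠ 1)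
    (h2 : ∀ ℓ : ℕ, (hℓ : ℓ.Prime) → ¬ (haveI := Fact.mk hℓ; W.HasSplitMultiplicativeReductionAtPrime ℓ))
    (h3 : ∀ ℓ : ℕ, (hℓ : ℓ.Prime) → ℓ ≠ p →
      (haveI := Fact.mk hℓ; ¬ W.HasGoodReductionAtPrime ℓ ∧ ¬ W.HasMultiplicativeReductionAtPrime ℓ) →
      ψ (ℓ : ZMod f) ≠ 1 ∧ KrizLi2019.primVal (KrizLi2019.invMulOmega ψ ω) ℓ ≠ 1)
    -- Kriz–Li's binders at `K`
    (εK : DirichletCharacter ℚ_[p] (NumberField.discr K).natAbs) (hεK : KrizLi2019.IsKroneckerCharacterOf K εK)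
    (h4 : ¬ (‖KrizLi2019.bernoulliOnePrim (KrizLi2019.bernoulliCharOne ψ εK) *
        KrizLi2019.bernoulliOnePrim (KrizLi2019.bernoulliCharTwo ψ εK ω)‖ ≤ (p : ℝ)⁻¹))
    -- the regular frame
    (κ : ZpExtension K p) (hκ : κ.IsAnticyclotomic) (γ : absoluteGaloisGroup K) [Fact (κ.IsTopGenerator γ)]
    (𝔭 : HeightOneSpectrum (𝓞 K)) (h𝔭 : ((p : ℕ) : 𝓞 K) ∈ 𝔭.asIdeal)
    (h0 : XAc.HasCharValuationAt (W.baseChange K) p κ 𝔭 ∅ γ 0) : BSDp W p := by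
  have hp : p.Prime := Fact.out
  have hp2 : p ≠ 2 := by omega
  have hadd : Addv W p := addv_of_cmRamified W hCM hram h5
  have hpN : p ∣ N := by
    rw [← hN]; exact (W.dvd_conductorNorm_iff_not_hasGoodReductionAtPrime p).mpr hadd.1
  obtain ⟨he, hf⟩ := UniversalToricDescentStrictPlace.degreeOne_of_dvd_of_heegner hK hHH hpN h𝔭
  -- the Heegner point is non-torsion (Gross–Zagier in analytic rank one, modularity)
  have hL0 : W.entireLFunction 1 = 0 := entireLFunction_one_eq_zero_of_analyticRank_eq_one hr
  obtain ⟨-, hderiv⟩ := leadingLCoeff_eq_deriv_of_analyticRank_eq_one hr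
  haveI hN0 : NeZero (W.conductorNorm ℤ) := ⟨W.conductorNorm_pos_holds.ne'⟩
  have hLK : LDerivEK W K ≠ 0 := by
    rw [KrizLi2019.lDerivEK_eq_deriv_mul W K hmod hL0]; exact mul_ne_zero hderiv hLd
  have hnt : ¬ IsOfFinAddOrder P :=
    (lDerivEK_ne_zero_iff_not_isOfFinAddOrder W N K (hF.1 _ W K) hK hHH ⟨Dt, H, ι, hP⟩).mp hLK
  -- `v_p(c) = 0`
  have hc0 : padicValNat p Dt.c.natAbs = 0 := by
    refine padicValNat.eq_zero_of_not_dvd fun h ↦ hc ?_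
    exact Int.natCast_dvd.mpr h
  -- Kriz–Li: `ord_p log_ω P ≤ v_p(c)`
  have hsplit : ((Ideal.span {(p : ℤ)}).primesOver (𝓞 K)).ncard = 2 := by rw [← hN] at hHH; exact hHH p hp (hN ▸ hpN)
  haveI : NeZero (NumberField.discr K).natAbs := ⟨Int.natAbs_ne_zero.mpr (NumberField.discr_ne_zero K)⟩
  have hle : X11b.padicLogOrd W p (embAt K p 𝔭 h𝔭 he hf) P ≤ (padicValNat p Dt.c.natAbs : ℤ) := by
    subst hN
    have hne := hKL p hp2 W f ψ ω hψ hω hss h1 h1' h2 h3 Dt K hK hHH hsplit εK hεK H ι (embAt K p 𝔭 h𝔭 he hf) P hP h4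
    exact (SchneiderFree.padicLogOrd_le_padicValInt_of_krizLi (SchneiderFree.nsPointCount_eq_self_of_addv hadd) hne).2.2
  -- integrality: `0 ≤ ord_p log_ω P`
  have hge : (padicValNat p Dt.c.natAbs : ℤ) ≤ X11b.padicLogOrd W p (embAt K p 𝔭 h𝔭 he hf) P := by
    rw [hc0, Nat.cast_zero]
    exact padicLogOrd_nonneg_of_addv_of_five_le W h5 hadd _ hnt
  exact bsdp_cmRamified_of_regularFrame_of_padicLogOrd hF hPT2 hBF hmod W hCM hram h5 hr N K Dt H ι P hN hK hodd hd4 hHH hLd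
    hP κ hκ γ 𝔭 h𝔭 he hf h0 hle hge

/-- **The crux's CONCLUSION for `W` on the REGULAR KRIZ–LI LOCUS, modulo PRINT only** —
`X12.O11.RamifiedCMBottomClassIndexLawAtZp W p` (the statement of `PrintCFram.BottomClassIndexLawFiveLe` for this one `W`, under
its own GZK antecedent) from `bsdp_cmRamified_of_regularFrame_of_thm120` and k7r-c4's `ramifiedCMBottomClassIndexLawAtZp_of_bsdp`
(+ Cassels). Inputs beyond the crux's binders: ONE Kriz–Li datum `(K'', P)` with `p ∤ c`, ONE regular frame — and the named
facts Kriz–Li 2019 Thm. 1.20, `ToricPublishedInputs`, Poitou–Tate for Ш, Burungale–Flach, modularity, Cassels, GZK. CONDITIONAL;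
the crux (all `W`, all frames) is NOT closed; BSD is not proved by any of this.
[cite: KrizLi2019, Thm. 1.20 and Rem. 1.21 (doi:10.1017/fms.2019.9)] [cite: Miller2011LMS, Def. 1.1 (arXiv:1010.2431 p. 3)]
[cite: Cassels1965ArithmeticVIII] -/
theorem ramifiedCMBottomClassIndexLawAtZp_of_regularFrame_of_thm120
    (hKL : KrizLi2019.thm120_padicLogHeegner_unit_of_bernoulli)
    (hF : ToricPublishedInputs) (hPT2 : ∀ (K : Type) [Field K] [NumberField K], poitouTate_sha_tateDual K)
    (hBF : bsdTriple_of_hasCM_of_L_one_ne_zero) (hmod : hasEntireLFunction_rat) (hCassels : bsdRHS_eq_of_isIsogenous)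
    (hGZK : rank_eq_analyticRank_of_analyticRank_le_one)
    (W : WeierstrassCurve ℚ) [W.IsElliptic] [W.IsGloballyMinimal] (hCM : W.HasCM) (hram : CMRamified W p) (h5 : 5 ≤ p)
    (hr : W.analyticRank = 1) (N : ℕ) [NeZero N] (K : Type) [Field K] [NumberField K]
    (Dt : ModularParametrizationData W N) (H : HeegnerDatum N (NumberField.discr K)) (ι : K →+* ℂ)
    (P : (W.baseChange K).toAffine.Point) (hN : W.conductorNorm ℤ = N) (hK : IsImaginaryQuadratic K)
    (hodd : Odd (NumberField.discr K)) (hd4 : NumberField.discr K < -4) (hHH : SatisfiesHeegnerHypothesis N K)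
    (hLd : (W.quadraticTwist (NumberField.discr K : ℚ)).entireLFunction 1 ≠ 0)
    (hP : WeierstrassCurve.Affine.Point.map ι.toRatAlgHom P = heegnerPointComplex Dt H) (hc : ¬ (p : ℤ) ∣ Dt.c)
    (f : ℕ) [NeZero f] (ψ : DirichletCharacter ℚ_[p] f) (ω : DirichletCharacter ℚ_[p] p)
    (hψ : ψ.IsPrimitive) (hω : KrizLi2019.IsTeichmullerCharacter ω)
    (hss : ∀ ℓ : ℕ, ℓ.Prime → ¬ (ℓ ∣ p * W.conductorNorm ℤ) →
      ‖((W.LFunction ℓ : ℤ) : ℚ_[p]) - (ψ (ℓ : ZMod f) + ψ⁻¹ (ℓ : ZMod f) * ω (ℓ : ZMod p))‖ < 1)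
    (h1 : ψ (p : ZMod f) ≠ 1) (h1' : KrizLi2019.primVal (KrizLi2019.invMulOmega ψ ω) p ≠ 1)
    (h2 : ∀ ℓ : ℕ, (hℓ : ℓ.Prime) → ¬ (haveI := Fact.mk hℓ; W.HasSplitMultiplicativeReductionAtPrime ℓ))
    (h3 : ∀ ℓ : ℕ, (hℓ : ℓ.Prime) → ℓ ≠ p →
      (haveI := Fact.mk hℓ; ¬ W.HasGoodReductionAtPrime ℓ ∧ ¬ W.HasMultiplicativeReductionAtPrime ℓ) →
      ψ (ℓ : ZMod f) ≠ 1 ∧ KrizLi2019.primVal (KrizLi2019.invMulOmega ψ ω) ℓ ≠ 1)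
    (εK : DirichletCharacter ℚ_[p] (NumberField.discr K).natAbs) (hεK : KrizLi2019.IsKroneckerCharacterOf K εK)
    (h4 : ¬ (‖KrizLi2019.bernoulliOnePrim (KrizLi2019.bernoulliCharOne ψ εK) *
        KrizLi2019.bernoulliOnePrim (KrizLi2019.bernoulliCharTwo ψ εK ω)‖ ≤ (p : ℝ)⁻¹))
    (κ : ZpExtension K p) (hκ : κ.IsAnticyclotomic) (γ : absoluteGaloisGroup K) [Fact (κ.IsTopGenerator γ)]
    (𝔭 : HeightOneSpectrum (𝓞 K)) (h𝔭 : ((p : ℕ) : 𝓞 K) ∈ 𝔭.asIdeal)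
    (h0 : XAc.HasCharValuationAt (W.baseChange K) p κ 𝔭 ∅ γ 0) :
    X12.O11.RamifiedCMBottomClassIndexLawAtZp W p :=
  RubinFormulaZpBsdp.ramifiedCMBottomClassIndexLawAtZp_of_bsdp hCassels hmod hGZK hr.le
    (bsdp_cmRamified_of_regularFrame_of_thm120 hKL hF hPT2 hBF hmod W hCM hram h5 hr N K Dt H ι P hN hK hodd hd4 hHH hLd hP hc
      f ψ ω hψ hω hss h1 h1' h2 h3 εK hεK h4 κ hκ γ 𝔭 h𝔭 h0)

/-- **The same, with regularity DISPLAYED as «both character residual Selmer groups trivial at the frame»** (p629673's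
`hasCharValuationAt_zero_cmRamified_of_trivial_residualSelmer`): on a Kriz–Li datum `(K'', P)` of a CM-ramified `W` with `p ∤ c`
and one frame `(κ, γ, 𝔭′)` at which every residual line with the local clause has trivial residual Selmer groups, the crux's
conclusion `RamifiedCMBottomClassIndexLawAtZp W p` holds modulo print (Kriz–Li Thm. 1.20, `ToricPublishedInputs`, PT-Ш,
Burungale–Flach, modularity, Cassels, GZK). CONDITIONAL; BSD is not proved by any of this.
[cite: KrizLi2019, Thm. 1.20, Rem. 1.21 and p. 3 (doi:10.1017/fms.2019.9)] [cite: CastellaGrossiLeeSkinner2022, §3 (arXiv:2008.02571)] -/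
theorem ramifiedCMBottomClassIndexLawAtZp_of_trivial_residualSelmer_of_thm120
    (hKL : KrizLi2019.thm120_padicLogHeegner_unit_of_bernoulli)
    (hF : ToricPublishedInputs) (hPT2 : ∀ (K : Type) [Field K] [NumberField K], poitouTate_sha_tateDual K)
    (hBF : bsdTriple_of_hasCM_of_L_one_ne_zero) (hmod : hasEntireLFunction_rat) (hCassels : bsdRHS_eq_of_isIsogenous)
    (hGZK : rank_eq_analyticRank_of_analyticRank_le_one)
    (W : WeierstrassCurve ℚ) [W.IsElliptic] [W.IsGloballyMinimal] (hCM : W.HasCM) (hram : CMRamified W p) (h5 : 5 ≤ p)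
    (hr : W.analyticRank = 1) (N : ℕ) [NeZero N] (K : Type) [Field K] [NumberField K]
    (Dt : ModularParametrizationData W N) (H : HeegnerDatum N (NumberField.discr K)) (ι : K →+* ℂ)
    (P : (W.baseChange K).toAffine.Point) (hN : W.conductorNorm ℤ = N) (hK : IsImaginaryQuadratic K)
    (hodd : Odd (NumberField.discr K)) (hd4 : NumberField.discr K < -4) (hHH : SatisfiesHeegnerHypothesis N K)
    (hLd : (W.quadraticTwist (NumberField.discr K : ℚ)).entireLFunction 1 ≠ 0)
    (hP : WeierstrassCurve.Affine.Point.map ι.toRatAlgHom P = heegnerPointComplex Dt H) (hc : ¬ (p : ℤ) ∣ Dt.c)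
    (f : ℕ) [NeZero f] (ψ : DirichletCharacter ℚ_[p] f) (ω : DirichletCharacter ℚ_[p] p)
    (hψ : ψ.IsPrimitive) (hω : KrizLi2019.IsTeichmullerCharacter ω)
    (hss : ∀ ℓ : ℕ, ℓ.Prime → ¬ (ℓ ∣ p * W.conductorNorm ℤ) →
      ‖((W.LFunction ℓ : ℤ) : ℚ_[p]) - (ψ (ℓ : ZMod f) + ψ⁻¹ (ℓ : ZMod f) * ω (ℓ : ZMod p))‖ < 1)
    (h1 : ψ (p : ZMod f) ≠ 1) (h1' : KrizLi2019.primVal (KrizLi2019.invMulOmega ψ ω) p ≠ 1)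
    (h2 : ∀ ℓ : ℕ, (hℓ : ℓ.Prime) → ¬ (haveI := Fact.mk hℓ; W.HasSplitMultiplicativeReductionAtPrime ℓ))
    (h3 : ∀ ℓ : ℕ, (hℓ : ℓ.Prime) → ℓ ≠ p →
      (haveI := Fact.mk hℓ; ¬ W.HasGoodReductionAtPrime ℓ ∧ ¬ W.HasMultiplicativeReductionAtPrime ℓ) →
      ψ (ℓ : ZMod f) ≠ 1 ∧ KrizLi2019.primVal (KrizLi2019.invMulOmega ψ ω) ℓ ≠ 1)
    (εK : DirichletCharacter ℚ_[p] (NumberField.discr K).natAbs) (hεK : KrizLi2019.IsKroneckerCharacterOf K εK)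
    (h4 : ¬ (‖KrizLi2019.bernoulliOnePrim (KrizLi2019.bernoulliCharOne ψ εK) *
        KrizLi2019.bernoulliOnePrim (KrizLi2019.bernoulliCharTwo ψ εK ω)‖ ≤ (p : ℝ)⁻¹))
    (κ : ZpExtension K p) (hκ : κ.IsAnticyclotomic) (γ : absoluteGaloisGroup K) [Fact (κ.IsTopGenerator γ)]
    (𝔭 : HeightOneSpectrum (𝓞 K)) (h𝔭 : ((p : ℕ) : 𝓞 K) ∈ 𝔭.asIdeal)
    (htriv : ∀ (Φ : X2.ResidualDevissageModules.StableSubgroup (absoluteGaloisGroup K) ((W.baseChange K).geomTorsion (p : ℤ))),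
      (∀ y : Φ.Quot, (∀ g : ↥(κ.kerSubgroup ⊓ decomp 𝔭), g • y = y) → y = 0) →
      Nat.card (datumStrictSelmer κ.kerSubgroup Φ.Sub p (AcSelmer.bdpData Φ.Sub p 𝔭)
          {v : HeightOneSpectrum (𝓞 K) | ¬ (W.baseChange K).HasGoodReductionAt v ∧ ((p : ℕ) : 𝓞 K) ∉ v.asIdeal}) = 1 ∧
      Nat.card (datumStrictSelmer κ.kerSubgroup Φ.Quot p (AcSelmer.bdpData Φ.Quot p 𝔭)
          {v : HeightOneSpectrum (𝓞 K) | ¬ (W.baseChange K).HasGoodReductionAt v ∧ ((p : ℕ) : 𝓞 K) ∉ v.asIdeal}) = 1) :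
    X12.O11.RamifiedCMBottomClassIndexLawAtZp W p :=
  ramifiedCMBottomClassIndexLawAtZp_of_regularFrame_of_thm120 hKL hF hPT2 hBF hmod hCassels hGZK W hCM hram h5 hr N K Dt H ι P
    hN hK hodd hd4 hHH hLd hP hc f ψ ω hψ hω hss h1 h1' h2 h3 εK hεK h4 κ hκ γ 𝔭 h𝔭
    (hasCharValuationAt_zero_cmRamified_of_trivial_residualSelmer W hCM hram h5 hN hK hHH κ γ 𝔭 h𝔭 htriv)

end CMRamified

end Summit.BirchSwinnertonDyer.BirchSwinnertonDyer.Theorems.PrintCFram.EisensteinRegularLocus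

end
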